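/-
Copyright (c) 2026 the pub-hodgecm2 formalisation cell (harness21).  New file, outside the frozen port manifest.
Origin: seat `prover-pub-hodgecm2-d2bridge-prove-2-g0-0` (unit pub-hodgecm2-d2bridge-prove-2, Δ2 BRIDGE team; COORDINATOR «Δ2 RESTRUCTURE
FOR SPEED» pub-hodgecm2/INBOX l.10757: prove-2 = sublemma S2), 2026-08-23.  Sibling of `OmegaLevelwisePullback.lean` (the CONSTRUCTION of
the proof map (4.2) on the real `Ω(μ)`): the three further laws of `Map43RationalData` for that construction, and the ASSEMBLED record.
Theorems + one definition (`map43RecordOfLevels`); no named fact, no `sorry`, no new axiom; count-neutral; HC_CM is NOT proved; «Δ2 BRIDGE CLOSED» is NOT claimed.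
-/
import Summits.HodgeConjecture.CorCM.D2Bridge.OmegaLevelwisePullback
import HarnessLib

set_option autoImplicit false

/-!
# Δ2 bridge, sublemma S2 (sequel): the laws `P_smul`, `P_injective`, `P_comm` of the CONSTRUCTED pull-back (4.2) on
# `Ω(μ) = colim_K Hom_E(A_K, A_μ)_ℚ`, reduced to level-wise Betti primitives

Y. Liu, *Fourier–Jacobi cycles and arithmetic relative trace formula*, Camb. J. Math. **9** (2021) 1–147 = arXiv:2102.11518 [Liu2021];
TeX source `FJcycle.tex` (md5 `6db49a74122d…`; `l. NNNN` = its lines).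

`OmegaLevelwisePullback.lean` CONSTRUCTS the field `P : Ω(μ) →+ (H¹_B(A_μ; ℚ) →ₗ[ℚ] H¹_{B,τ'}(A_∞, ℚ))` of the proof-objects record
`Map43RationalData` ([Liu2021] proof of Thm. 4.18, l. 2247–2253) on the REAL `Ω(μ)` of the one-object rest (`RestOne.ΩOf ∕ ΩOne`) from
level-wise Betti pull-back data `Λ : LevelwiseBettiPullback C B L U`, with its level-`K` law (`PΩ_resOf`) = the skeleton's S2 law `P_eq`.
THIS FILE reduces the record's three remaining laws about `P` to level-wise primitives of the pin:

* §4 `PΩ_smul ∕ PΩ_smul'` — `P_smul` («`M_μ` acts via `i_μ`», Def. 4.16 l. 2219): `(s · f)^* = f^* ∘ i(s)^*`, from the `ℚ`-linear action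
  `endStarQ` of `End⁰(B)` on `L = H¹_B(B; ℚ)` with functoriality `(φ ≫ β)^* = φ^* ∘ β^*` (`hpost`) and the reading `hmod` of the `M_μ`-module
  structure of `L` through `i_μ`;
* §5 `PΩ_injective` — `P_injective`: faithfulness of `φ ↦ φ^*` on each `Hom_E(A_K, B)_ℚ` (`hfaith`) + injectivity of each tower map (`htr`);
  the sufficiently small levels are co-directed (`smallLevel_exists_le_le`);
* §6 `PΩ_hecke ∕ PΩOne_rhoΩOne` — `P_comm` for the CONSTRUCTED Hecke action (`AppendixC/RestOneHecke.lean`: `hecke`, `rhoΩOne`):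
  `(g · f)^* = ρU(g) ∘ f^*`, modulo the ONE pin law `hU` «the Hecke action `ρU` on the rational tower is induced by the `Alb(T_g)^*`» (l. 2074);
* §7 `map43RecordOfLevels` — THE ASSEMBLED proof-objects record `Map43RationalData` over `toThm418Data C (T.restOne …)` with `P := PΩOne`
  and the four `P`-laws DISCHARGED by §4–§6, from the J-half (`U ∕ ρU ∕ HB ∕ ρB ∕ ι`), the CM line `L = H¹_B(A_μ; ℚ)` with `α`, the level data
  `Λ` and the pin primitives — the binder group R2 «`M`» of the bridge reduced to named inputs; for it the skeleton's S2 law is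
  `map42_P_eq … rfl`.

KERNEL throughout: the ADDITIVE uniqueness out of the direct limit (Mathlib `AddCon.hom_ext` + `DirectSum.addHom_ext'`) and the level-`K`
law `PΩ_resOf`.  Nothing about Liu's objects is asserted; HC_CM is NOT proved; «Δ2 BRIDGE CLOSED» is NOT claimed.

## References
* [Liu2021] §4.2 l. 2062–2081; Def. 4.16 and Rem. 4.17 (l. 2215–2228); proof of Thm. 4.18, map (4.2)/(4.3) (l. 2247–2253).
* Tree: `CorCM/D2Bridge/OmegaLevelwisePullback.lean` (this seat), `Liu2021/AppendixC/RestOne.lean`, `Liu2021/AppendixC/RestOneHecke.lean`,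
  `Motives/AbelianVarietyEndAlgebraSemisimpleProofs.lean` (`endAlgebra.exists_eq_algebraMap_mul_of`).
-/

noncomputable section

open scoped TensorProduct
open CategoryTheory NumberField
open Literature.AlgebraicGeometry.Motives (AbelianVariety)

namespace Summit.HodgeConjecture.CorCM.D2Bridge

universe u v w

/-! ## §4  The `M_μ`-linearity law `P_smul` of the constructed (4.2) («`M_μ` acts via `i_μ`», Def. 4.16) -/

section Smul

open Literature.NumberTheory.Automorphic Literature.NumberTheory.Automorphic.Liu2021 Literature.NumberTheory.Automorphic.Liu2021.AppendixC
open Literature.NumberTheory.Automorphic.Liu2021.AppendixC.RestOne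
open Literature.AlgebraicGeometry.Motives.AbelianVariety (endAlgebra)

variable {F E : Type} [Field F] [NumberField F] [IsTotallyReal F] [Field E] [NumberField E] [Algebra F E]
  [IsTotallyComplex E] [Algebra.IsQuadraticExtension F E]
variable {P5 : PropC5Data F E} {isotropicAt : ℕ → Prop} {C : Sec42Data P5 isotropicAt} {B : AbelianVariety E}
variable {L : Type} [AddCommGroup L] [Module ℚ L] {U : Type} [AddCommGroup U] [Module ℚ U]
  (Λ : LevelwiseBettiPullback C B L U) (S : Type) [Ring S] [EndScalar S B]
  (endStarQ : endAlgebra B →ₗ[ℚ] Module.End ℚ L)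
  (hpost : ∀ (K : C5.SmallLevel C.S.K₀) (φ : C.A K ⟶ B) (β : End B),
    Λ.phiStarQ K (φ ≫ End.asHom β) = Λ.phiStarQ K φ ∘ₗ endStarQ (endAlgebra.of B β))

namespace LevelwiseBettiPullback

include hpost in
/-- **`M_μ`-compatibility of the level pieces**: for `s ∈ S` acting on `Hom_E(A_K, B)_ℚ` through `i : S → End⁰(B)` by postcomposition
(`RestOne.moduleQHom`, [Liu2021] Def. 4.16 «`M_μ` acts via `i_μ`», l. 2219) and `End⁰(B)` acting on `L = H¹_B(B; ℚ)` by the `ℚ`-linear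
extension `endStarQ` of `β ↦ β^*` (FUNCTORIALITY `(φ ≫ β)^* = φ^* ∘ β^*`, hypothesis `hpost`): `(s · t)^* = t^* ∘ i(s)^*`.  Normal form
`i(s) = M⁻¹ · (1 ⊗ F)` in `End⁰(B)` (tree `endAlgebra.exists_eq_algebraMap_mul_of`). [cite: Liu2021, Def. 4.16 (FJcycle.tex l. 2215–2219)] -/
theorem levelMap_smul (K : C5.SmallLevel C.S.K₀) (s : S) (t : C.HomQ K B) :
    Λ.levelMap K (s • t) = Λ.levelMap K t ∘ₗ endStarQ (EndScalar.hom (B := B) s) := by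
  obtain ⟨M, G, -, hs⟩ := endAlgebra.exists_eq_algebraMap_mul_of (EndScalar.hom (B := B) s)
  have hsm : endStarQ (EndScalar.hom (B := B) s) = ((M : ℚ)⁻¹) • endStarQ (endAlgebra.of B G) := by
    rw [hs, ← Algebra.smul_def, map_smul]
  induction t using TensorProduct.induction_on with
  | zero => rw [smul_zero, map_zero, LinearMap.zero_comp]
  | tmul q φ =>
    rw [smul_def (C.A K) B S s, hsm, hs, map_mul, AlgHom.commutes, postAlg_of, Module.End.mul_apply,
      Module.algebraMap_end_apply, post_tmul, TensorProduct.smul_tmul', levelMap_apply, levelMap_apply,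
      phiStarQHom_tmul, phiStarQHom_tmul, hpost]
    refine LinearMap.ext fun l => ?_
    simp only [LinearMap.comp_apply, LinearMap.smul_apply, map_smul, smul_smul, smul_eq_mul, mul_comm]
  | add t t' ht ht' => rw [smul_add, map_add, map_add, ht, ht', LinearMap.add_comp]

include hpost in
open scoped Classical in
/-- **The law `P_smul` of the constructed (4.2) on `Ω = colim_K Hom_E(A_K, B)_ℚ`**: `(s · f)^* = f^* ∘ i(s)^*` for every `s ∈ S` — «`M_μ`
acts via `i_μ`» ([Liu2021] Def. 4.16, l. 2219) and functoriality of Betti `H¹`.  KERNEL: the two additive maps `f ↦ (s · f)^*` and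
`f ↦ f^* ∘ i(s)^*` out of the direct limit agree on every component (`levelMap_smul`; Mathlib `AddCon.hom_ext` ∕ `DirectSum.addHom_ext'`).
[cite: Liu2021, Def. 4.16 (FJcycle.tex l. 2215–2219) and proof of Thm. 4.18 (l. 2248–2250)] -/
theorem PΩ_smul (s : S) (x : ΩOf C B S) :
    Λ.PΩ S (s • x) = Λ.PΩ S x ∘ₗ endStarQ (EndScalar.hom (B := B) s) := by
  have key : (Λ.PΩ S).comp (DistribSMul.toAddMonoidHom (ΩOf C B S) s) =
      (LinearMap.lcomp ℚ U (endStarQ (EndScalar.hom (B := B) s))).toAddMonoidHom.comp (Λ.PΩ S) := by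
    refine AddCon.hom_ext (DirectSum.addHom_ext' fun i => AddMonoidHom.ext fun t => ?_)
    -- on the component `K = ofDual i`: `res_K` is `S`-linear (`DirectLimit.of`), then `levelMap_smul`
    have hres : s • resOf C B S (OrderDual.ofDual i) t = resOf C B S (OrderDual.ofDual i) (s • t) :=
      ((Module.DirectLimit.of S (Idx C) (sysObj C B) (sys C B S) i).map_smul s t).symm
    change Λ.PΩ S (s • resOf C B S (OrderDual.ofDual i) t) =
      Λ.PΩ S (resOf C B S (OrderDual.ofDual i) t) ∘ₗ endStarQ (EndScalar.hom (B := B) s)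
    rw [hres, Λ.PΩ_resOf, Λ.PΩ_resOf, ← levelMap_apply, ← levelMap_apply]
    exact Λ.levelMap_smul S endStarQ hpost (OrderDual.ofDual i) s t
  exact DFunLike.congr_fun key x

variable [Module S L]

include hpost in
open scoped Classical in
/-- **`P_smul` in the currency of `Map43RationalData`** (`P (m • f) = P f ∘ₗ (m • ·)`), for an `S`-module structure on `L = H¹_B(B; ℚ)`
that IS the one through `i` and `β ↦ β^*` (`hmod`; at the pin: `M_μ` acts on `H¹_{B,τ'}(A_μ, ℚ)` through `i_μ` and functoriality —
Def. 4.5 (2), l. 1948). [cite: Liu2021, Def. 4.16 (FJcycle.tex l. 2215–2219) and proof of Thm. 4.18 (l. 2248–2250)] -/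
theorem PΩ_smul' [SMulCommClass S ℚ L]
    (hmod : ∀ (s : S) (l : L), s • l = endStarQ (EndScalar.hom (B := B) s) l) (s : S) (x : ΩOf C B S) :
    Λ.PΩ S (s • x) = Λ.PΩ S x ∘ₗ DistribSMul.toLinearMap ℚ L s := by
  rw [Λ.PΩ_smul S endStarQ hpost]
  congr 1
  exact LinearMap.ext fun l => (hmod s l).symm

end LevelwiseBettiPullback

end Smul


/-! ## §5  The faithfulness law `P_injective` of the constructed (4.2), reduced to its two level-wise inputs -/

section Injective

open Literature.NumberTheory.Automorphic Literature.NumberTheory.Automorphic.Liu2021 Literature.NumberTheory.Automorphic.Liu2021.AppendixC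
open Literature.NumberTheory.Automorphic.Liu2021.AppendixC.RestOne

variable {F E : Type} [Field F] [NumberField F] [IsTotallyReal F] [Field E] [NumberField E] [Algebra F E]
  [IsTotallyComplex E] [Algebra.IsQuadraticExtension F E]
variable {P5 : PropC5Data F E} {isotropicAt : ℕ → Prop} (C : Sec42Data P5 isotropicAt) {B : AbelianVariety E}
variable {L : Type} [AddCommGroup L] [Module ℚ L] {U : Type} [AddCommGroup U] [Module ℚ U]

/-- **The sufficiently small levels are CO-DIRECTED**: two open compact subgroups `K, K' ⊆ K₀` contain the open compact subgroup
`K ∩ K'` (an open subgroup is closed, so `K ∩ K'` is compact) — the inductive system `{Hom_E(A_K, A_μ)_ℚ}_K` of §4.2 (l. 2070–2072) is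
directed. [folklore] -/
theorem smallLevel_exists_le_le (K K' : C5.SmallLevel C.S.K₀) : ∃ K'' : C5.SmallLevel C.S.K₀, K'' ≤ K ∧ K'' ≤ K' := by
  refine ⟨⟨⟨K.1.1 ⊓ K'.1.1, ?_, ?_⟩, le_trans (inf_le_left : K.1.1 ⊓ K'.1.1 ≤ K.1.1) K.2⟩, ?_, ?_⟩
  · simpa only [Subgroup.coe_inf] using K.1.2.1.inter K'.1.2.1
  · simpa only [Subgroup.coe_inf] using K.1.2.2.inter_right (Subgroup.isClosed_of_isOpen K'.1.1 K'.1.2.1)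
  · exact (inf_le_left : K.1.1 ⊓ K'.1.1 ≤ K.1.1)
  · exact (inf_le_right : K.1.1 ⊓ K'.1.1 ≤ K'.1.1)

variable {C} (Λ : LevelwiseBettiPullback C B L U) (S : Type) [Ring S] [EndScalar S B]

open scoped Classical in
/-- **The law `P_injective` of the constructed (4.2), REDUCED to its two level-wise inputs** (the docstring of
`Map43RationalData.P_injective`): if at every level `φ ↦ φ^*` is injective on `Hom_E(A_K, B)_ℚ = ℚ ⊗_ℤ Hom_E(A_K, B)` (`hfaith` —
faithfulness of rational Betti `H¹` on `Hom ⊗ ℚ` of abelian varieties, cf. tree `AbelianVariety.hom_eq_of_complexBetti_map_one_eq`) and the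
structure map `H¹_{B,τ'}(A_K, ℚ) → H¹_{B,τ'}(A_∞, ℚ)` is injective (`htr` — the transition pull-backs along the surjections `A_{K'} → A_K`),
then `f ↦ f^*` is injective on `Ω = colim_K Hom_E(A_K, B)_ℚ`.  KERNEL: every element of the directed colimit comes from one level
(`smallLevel_exists_le_le`, Mathlib `Module.DirectLimit.exists_of`), where (4.2) is `transK ∘ (·)^*` (`PΩ_resOf`).
[cite: Liu2021, §4.2 (FJcycle.tex l. 2070–2081) and proof of Thm. 4.18 (l. 2248–2266)] -/
theorem LevelwiseBettiPullback.PΩ_injective (hfaith : ∀ K : C5.SmallLevel C.S.K₀, Function.Injective (Λ.phiStarQHom K))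
    (htr : ∀ K : C5.SmallLevel C.S.K₀, Function.Injective (Λ.transKQ K)) :
    Function.Injective (Λ.PΩ S) := by
  haveI : Nonempty (Idx C) := ⟨OrderDual.toDual ⟨C.S.K₀, le_rfl⟩⟩
  haveI : IsDirectedOrder (Idx C) :=
    ⟨fun i j => by
      obtain ⟨K'', hK, hK'⟩ := smallLevel_exists_le_le C (OrderDual.ofDual i) (OrderDual.ofDual j)
      exact ⟨OrderDual.toDual K'', hK, hK'⟩⟩
  refine (injective_iff_map_eq_zero _).2 fun x hx => ?_
  obtain ⟨i, t, rfl⟩ := Module.DirectLimit.exists_of x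
  -- at the level `K = ofDual i`, (4.2) is `transK ∘ t^*`
  have hlevel : Λ.transKQ (OrderDual.ofDual i) ∘ₗ Λ.phiStarQHom (OrderDual.ofDual i) t = 0 := by
    rw [← Λ.PΩ_resOf S (OrderDual.ofDual i) t]
    exact hx
  have ht : Λ.phiStarQHom (OrderDual.ofDual i) t = 0 := by
    refine LinearMap.ext fun l => htr (OrderDual.ofDual i) ?_
    rw [LinearMap.zero_apply, map_zero, ← LinearMap.comp_apply, hlevel, LinearMap.zero_apply]
  have ht0 : t = 0 := hfaith (OrderDual.ofDual i) (by rw [ht, map_zero])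
  rw [ht0, map_zero]

end Injective


/-! ## §6  The Hecke-equivariance law `P_comm` of the constructed (4.2) («`𝔾(𝔸_F^∞)` acts via its action on `A_∞`», Def. 4.16 / l. 2074) -/

section Hecke

open Literature.NumberTheory.Automorphic Literature.NumberTheory.Automorphic.Liu2021 Literature.NumberTheory.Automorphic.Liu2021.AppendixC
open Literature.NumberTheory.Automorphic.Liu2021.AppendixC.RestOne

variable {F E : Type} [Field F] [NumberField F] [IsTotallyReal F] [Field E] [NumberField E] [Algebra F E]
  [IsTotallyComplex E] [Algebra.IsQuadraticExtension F E]
variable {P5 : PropC5Data F E} {isotropicAt : ℕ → Prop} {C : Sec42Data P5 isotropicAt} (T : C.HeckeTranslates)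
  {B : AbelianVariety E}
variable {L : Type} [AddCommGroup L] [Module ℚ L] {U : Type} [AddCommGroup U] [Module ℚ U]
  (Λ : LevelwiseBettiPullback C B L U) (S : Type) [Ring S] [EndScalar S B]
  (ρU : Representation ℚ C.G U)
  (hU : ∀ (g : C.G) (K₁ K : C5.SmallLevel C.S.K₀) (h : C5.HeckeLE g K₁ K),
    Λ.transKQ K₁ ∘ₗ Λ.pbQ (T.albTr g K₁ K h) = ρU g ∘ₗ Λ.transKQ K)

namespace LevelwiseBettiPullback

include hU in
/-- The level pieces intertwine the pull-back along a Hecke translate `Alb(T_g) : A_{K₁} → A_K` (`g⁻¹K₁g ⊆ K`) with the action `ρU g`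
on the rational tower — functoriality `phiStarQ_comp` + the ONE pin law `hU`: «the Hecke action on `H¹_{B,τ'}(A_∞, ℚ)` is induced by the
`Alb(T_g)^*`» ([Liu2021] §4.2 l. 2074 «the Hecke correspondences provide a homomorphism `𝔾(𝔸_F^∞) → Aut_E(A_∞)`»).
[cite: Liu2021, §4.2 (FJcycle.tex l. 2070–2074) and Def. 4.16 (l. 2219)] -/
theorem levelMap_pre_albTr (g : C.G) {K₁ K : C5.SmallLevel C.S.K₀} (h : C5.HeckeLE g K₁ K) (t : C.HomQ K B) :
    Λ.levelMap K₁ (pre B (T.albTr g K₁ K h) t) = ρU g ∘ₗ Λ.levelMap K t := by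
  induction t using TensorProduct.induction_on with
  | zero => rw [map_zero, map_zero, map_zero, LinearMap.comp_zero]
  | tmul q φ =>
    rw [pre_tmul, levelMap_apply, levelMap_apply, phiStarQHom_tmul, phiStarQHom_tmul, Λ.phiStarQ_comp,
      LinearMap.comp_smul, LinearMap.comp_smul, LinearMap.comp_smul, ← LinearMap.comp_assoc, hU, LinearMap.comp_assoc]
  | add t t' ht ht' => rw [map_add, map_add, map_add, ht, ht', LinearMap.comp_add]

include hU in
open scoped Classical in
/-- **The law `P_comm` of the constructed (4.2) on `Ω = colim_K Hom_E(A_K, B)_ℚ`**: `(g · f)^* = ρU(g) ∘ f^*` for the Hecke action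
`HeckeTranslates.hecke` of `𝔾(𝔸_F^∞)` on `Ω` (`AppendixC/RestOneHecke.lean`: `g · res_K t = res_{K₁} (Alb(T_g)^* t)`) and the action `ρU`
on the rational tower — [Liu2021] Def. 4.16 l. 2219 «acts `M_μ`-linearly via its action on `A_∞`», both actions induced by the ONE
homomorphism `𝔾(𝔸_F^∞) → Aut_E(A_∞)` of l. 2074 (`hU`).  KERNEL: additive uniqueness out of the direct limit (`AddCon.hom_ext`), the defining
formula `hecke_resOf` at the conjugate level `heckeLevel g K`, and `levelMap_pre_albTr`.
[cite: Liu2021, Def. 4.16 (FJcycle.tex l. 2219), §4.2 (l. 2070–2074) and proof of Thm. 4.18 (l. 2248–2250)] -/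
theorem PΩ_hecke (g : C.G) (x : ΩOf C B S) :
    Λ.PΩ S (T.hecke B S g x) = ρU g ∘ₗ Λ.PΩ S x := by
  have key : (Λ.PΩ S).comp (T.hecke B S g).toAddMonoidHom =
      (LinearMap.llcomp ℚ L U U (ρU g)).toAddMonoidHom.comp (Λ.PΩ S) := by
    refine AddCon.hom_ext (DirectSum.addHom_ext' fun i => AddMonoidHom.ext fun t => ?_)
    change Λ.PΩ S (T.hecke B S g (resOf C B S (OrderDual.ofDual i) t)) = ρU g ∘ₗ Λ.PΩ S (resOf C B S (OrderDual.ofDual i) t)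
    rw [T.hecke_resOf B S g (C5.heckeLE_heckeLevel g (OrderDual.ofDual i)) t, Λ.PΩ_resOf, Λ.PΩ_resOf, ← levelMap_apply,
      ← levelMap_apply]
    exact Λ.levelMap_pre_albTr T ρU hU g (C5.heckeLE_heckeLevel g (OrderDual.ofDual i)) t
  exact DFunLike.congr_fun key x

include hU in
open scoped Classical in
/-- The same read as `Map43RationalData.P_comm` does, through a `Representation` on `Ω` agreeing with `hecke` (`HeckeTranslates.heckeRep`,
`heckeRep_apply` is `rfl`). [cite: Liu2021, Def. 4.16 (FJcycle.tex l. 2219) and §4.2 (l. 2074)] -/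
theorem PΩ_heckeRep (g : C.G) (x : ΩOf C B S) :
    Λ.PΩ S (T.heckeRep B S g x) = ρU g ∘ₗ Λ.PΩ S x :=
  Λ.PΩ_hecke T S ρU hU g x

end LevelwiseBettiPullback

variable [IsCMField E] {Lg : Type} [Field Lg] [NumberField Lg] [IsGalois ℚ Lg] (emb : E →ₐ[ℚ] Lg) (ιg : Lg →+* ℂ)
  {μ : IdeleClassGroup E →ₜ* Circle} (hμ : IdeleClassGroup.IsConjugateSymplectic E μ)
  (hw : IdeleClassGroup.HasWeight E μ 1) (Car : Def45.Carriers E μ)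

open scoped Classical in
/-- **`P_comm` at the one-object rest with its CONSTRUCTED Hecke action `rhoΩOne`** (`AppendixC/RestOneHecke.lean`, the `rhoΩ` of
`HeckeTranslates.restOne`): `(4.2) (g · x) = ρU(g) ∘ (4.2) x` on `Ω(μ) = ΩOne`, for the record built with `P := PΩOne` — the law
`Map43RationalData.P_comm` modulo the ONE pin law `hU` (the Hecke action on the rational tower is induced by the `Alb(T_g)^*`).
[cite: Liu2021, Def. 4.16 (FJcycle.tex l. 2219), §4.2 (l. 2074) and proof of Thm. 4.18 (l. 2248–2250)] -/
theorem PΩOne_rhoΩOne (D : ObjOne emb ιg hμ hw Car) (Λ : LevelwiseBettiPullback C (AμOne emb ιg hμ hw Car D) L U)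
    (hU : ∀ (g : C.G) (K₁ K : C5.SmallLevel C.S.K₀) (h : C5.HeckeLE g K₁ K),
      Λ.transKQ K₁ ∘ₗ Λ.pbQ (T.albTr g K₁ K h) = ρU g ∘ₗ Λ.transKQ K)
    (g : C.G) (x : ΩOne C emb ιg hμ hw Car) :
    PΩOne C emb ιg hμ hw Car D Λ (T.rhoΩOne emb ιg hμ hw Car g x) = ρU g ∘ₗ PΩOne C emb ιg hμ hw Car D Λ x := by
  change Λ.PΩ (fieldOfValues E μ) (T.rhoΩOne emb ιg hμ hw Car g x D) = ρU g ∘ₗ Λ.PΩ (fieldOfValues E μ) (x D)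
  rw [Sec42Data.HeckeTranslates.rhoΩOne_apply]
  exact Λ.PΩ_hecke T (fieldOfValues E μ) ρU hU g (x D)

end Hecke


/-! ## §7  ASSEMBLY: the proof-objects record `Map43RationalData` at the one-object rest, with `P := PΩOne` and its four laws DISCHARGED -/

section Record

open Literature.NumberTheory.Automorphic Literature.NumberTheory.Automorphic.Liu2021 Literature.NumberTheory.Automorphic.Liu2021.AppendixC
open Literature.NumberTheory.Automorphic.Liu2021.AppendixC.RestOne
open Literature.AlgebraicGeometry.Motives.AbelianVariety (endAlgebra)

variable {F E : Type} [Field F] [NumberField F] [IsTotallyReal F] [Field E] [NumberField E] [Algebra F E]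
  [IsTotallyComplex E] [Algebra.IsQuadraticExtension F E] [IsCMField E]
variable {P5 : PropC5Data F E} {isotropicAt : ℕ → Prop} {C : Sec42Data P5 isotropicAt} (T : C.HeckeTranslates)
variable {Lg : Type} [Field Lg] [NumberField Lg] [IsGalois ℚ Lg] (emb : E →ₐ[ℚ] Lg) (ιg : Lg →+* ℂ)
variable {μ : IdeleClassGroup E →ₜ* Circle} (hμ : IdeleClassGroup.IsConjugateSymplectic E μ)
  (hw : IdeleClassGroup.HasWeight E μ 1) (Car : Def45.Carriers E μ)
variable (Eps : Type) (epsOf : E → Eps) (Chi : Type) (omega : Eps → Chi → Type)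
  [∀ ε χ, AddCommGroup (omega ε χ)] [∀ ε χ, Module ℂ (omega ε χ)] (rho : ∀ ε χ, Representation ℂ C.G (omega ε χ))

/-- Evaluation at the chosen object is injective on `ΩOne = Π_{D : ObjOne} Ω_D` (the index `ObjOne` is a subsingleton).  Ours. [folklore] -/
theorem eval_objOne_injective (D : ObjOne emb ιg hμ hw Car) :
    Function.Injective fun ω : ΩOne C emb ιg hμ hw Car => ω D := by
  intro ω ω' h
  funext D'
  obtain rfl : D' = D := Subsingleton.elim D' D
  exact h

open scoped Classical in
/-- **THE PROOF-OBJECTS RECORD (4.2)/(4.3) AT THE ONE-OBJECT REST, ASSEMBLED** ([Liu2021] proof of Thm. 4.18, l. 2247–2253; the binder group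
R2 «`M`» of the Δ2 bridge): over `toThm418Data C (T.restOne …)` (REAL `Obj ∕ A_μ ∕ Ω(μ) ∕ rhoΩ ∕ res`), the `Map43RationalData` whose pull-back
`P` IS the constructed `PΩOne` and whose four `P`-laws are the THEOREMS of this file (`PΩ_smul'`, `PΩOne_rhoΩOne`, `PΩ_injective`), from:
the object `Dμ` (Prop. 4.6 (1)); the embedding `τ' ∈ Φ_μ` (l. 2250); the rational tower `U` with its Hecke action `ρU`, the complex carrier
`HB` (at the pin: the model's tower `T.H`) with `ρB`, and the comparison `ι` (injective, equivariant) — the J-half; `L = H¹_B(A_μ; ℚ)` as an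
`M_μ`-LINE (l. 650 + Def. 4.5 (2)) with the eigenvector `α` (l. 2250); the level-wise Betti data `Λ` (S2) with the pin primitives
`endStarQ ∕ hpost ∕ hmod` (Def. 4.16), `hU` (l. 2074), `hfaith` (faithfulness), `htr` (injective tower maps).  Over this record the printed
assertions (i)(ii)(iii) about (4.2)/(4.3) are THEOREMS (`Map43RationalData.map43AsPrinted`), and the skeleton's S2 law holds by `map42_P_eq … (M := this record) … rfl`
(the hypothesis `hMP : M.P = PΩOne …` is `rfl` here).  Nothing about Liu's objects is asserted beyond the displayed inputs; HC_CM is NOT proved; «Δ2 BRIDGE CLOSED» is NOT claimed.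
[cite: Liu2021, proof of Thm. 4.18 (FJcycle.tex l. 2247–2253); Rem. 4.17 (l. 2226–2228); Def. 4.16 (l. 2219); §4.2 (l. 2070–2081); l. 650 with Def. 4.5 (2)] -/
def map43RecordOfLevels (Dμ : ObjOne emb ιg hμ hw Car) (τ' : E →+* ℂ)
    (hτ' : τ' ∈ (toThm418Data C (T.restOne emb ιg hμ hw Car Eps epsOf Chi omega rho)).cmType.1)
    (U : Type) [AddCommGroup U] [Module ℚ U] (ρU : Representation ℚ C.G U)
    (HB : Type) [AddCommGroup HB] [Module ℂ HB] (ρB : Representation ℂ C.G HB)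
    (ι : ℂ ⊗[ℚ] U →ₗ[ℂ] HB) (hι : Function.Injective ι)
    (hιc : ∀ (g : C.G) (x : ℂ ⊗[ℚ] U), ι ((ρU g).baseChange ℂ x) = ρB g (ι x))
    (L : Type) [AddCommGroup L] [Module ℚ L] [Module (fieldOfValues E μ) L] [IsScalarTower ℚ (fieldOfValues E μ) L]
    (hL : Module.finrank (fieldOfValues E μ) L = 1) (α : ℂ ⊗[ℚ] L)
    (hα : ∀ m : fieldOfValues E μ, (DistribSMul.toLinearMap ℚ L m).baseChange ℂ α = algebraMap (fieldOfValues E μ) ℂ m • α)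
    (hα0 : α ≠ 0)
    (Λ : LevelwiseBettiPullback C (AμOne emb ιg hμ hw Car Dμ) L U)
    (endStarQ : endAlgebra (AμOne emb ιg hμ hw Car Dμ) →ₗ[ℚ] Module.End ℚ L)
    (hpost : ∀ (K : C5.SmallLevel C.S.K₀) (φ : C.A K ⟶ AμOne emb ιg hμ hw Car Dμ) (β : End (AμOne emb ιg hμ hw Car Dμ)),
      Λ.phiStarQ K (φ ≫ End.asHom β) = Λ.phiStarQ K φ ∘ₗ endStarQ (endAlgebra.of _ β))
    (hmod : ∀ (s : fieldOfValues E μ) (l : L), s • l = endStarQ (EndScalar.hom (B := AμOne emb ιg hμ hw Car Dμ) s) l)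
    (hU : ∀ (g : C.G) (K₁ K : C5.SmallLevel C.S.K₀) (h : C5.HeckeLE g K₁ K),
      Λ.transKQ K₁ ∘ₗ Λ.pbQ (T.albTr g K₁ K h) = ρU g ∘ₗ Λ.transKQ K)
    (hfaith : ∀ K : C5.SmallLevel C.S.K₀, Function.Injective (Λ.phiStarQHom K))
    (htr : ∀ K : C5.SmallLevel C.S.K₀, Function.Injective (Λ.transKQ K)) :
    (toThm418Data C (T.restOne emb ιg hμ hw Car Eps epsOf Chi omega rho)).Map43RationalData where
  Dμ := Dμ
  τ' := τ'
  τ'_mem := hτ'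
  U := U
  ρU := ρU
  HB := HB
  ρB := ρB
  ι := ι
  ι_injective := hι
  ι_comm := hιc
  L := L
  instModuleL := (inferInstance : Module (fieldOfValues E μ) L)
  instTowerL := (inferInstance : IsScalarTower ℚ (fieldOfValues E μ) L)
  rank_L := hL
  α := α
  α_mem := hα
  α_ne := hα0
  P := PΩOne C emb ιg hμ hw Car Dμ Λ
  P_smul m f := Λ.PΩ_smul' (fieldOfValues E μ) endStarQ hpost hmod m (f Dμ)
  P_comm g f := PΩOne_rhoΩOne T ρU emb ιg hμ hw Car Dμ Λ hU g f
  P_injective := (Λ.PΩ_injective (fieldOfValues E μ) hfaith htr).comp (eval_objOne_injective emb ιg hμ hw Car Dμ)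

end Record

end Summit.HodgeConjecture.CorCM.D2Bridge

end
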